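import Literature.NumberTheory.EllipticCurves.PadicSeriesEvaluation
import Summits.BirchSwinnertonDyer.BirchSwinnertonDyer.Theorems.RamifiedSevenEllipticUnitsUltrametricTransfer
import HarnessLib

set_option linter.dupNamespace false
set_option autoImplicit false

/-!
# K7r crux `EllipticUnitValueSevenOfGZK` (stmt-BirchSwinnertonDyer-19945), line `rubin-formula-zp`,
# research stub S_open — the RELATIVE VALUATION bookkeeping of ram g9's theorem over the ultrametric
# transfer, and concrete EVALUATION HOMOMORPHISMS of the Iwasawa algebra `Λ = ℤ_[p]⟦T⟧` at the points
# of `pℤ_p` (pure commutative algebra / topology; cell `bsd-cm`, seat `bsd-cm-k7r-c3` g8; helper,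
# `--supports` 19945; companion of `RamifiedSevenEllipticUnitsUltrametricTransfer.lean`, p485495)

HONEST FRAMING. Nothing here is about elliptic curves; nothing is asserted about the crux; BSD is not
proved by any of this. Memo RELATIVE-RUBIN-ram-g9.md (evidence #16 on 19945) §1 THEOREM: for members
`D`, `D₀ ∈ 𝒞₇` with `D₀` a UNIT member, `k = 7^m`, `v := ord_π ρ_k(D; D₀)`: (1) `v = ord_π 𝓛_D(ξ_k)`;
(2) `v < 1 + 2m ⇒ λ₀(D) = v`; (3) `λ₀(D) < 1 + 2m ⇒ v = λ₀(D)`; (4) `v ≥ min(λ₀(D), 1 + 2m)` — from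
(iii) the interpolation identities `𝓛_D(ξ_k) · Π_k(D) = A_k(D)` ([BKNO] Thm 4.12, PRE), (iv) the
D-independence of the period `Π_k` up to units, (v) `𝓛_{D₀}(ξ_k)` a unit, (vi) the ultrametric lemma,
(i) `ord_π(u^k − 1) = 1 + 2m`. The companion file PROVED (vi) and (i). THIS file:
* §A (RR) `map_mul_eq_of_interpolation`: `ℓ·per = A`, `ℓ₀·per₀ = A₀`, `v per = v per₀`, `v ℓ₀ = 1`
  ⇒ `v ℓ · v A₀ = v A` (= (1), «`ord 𝓛_D(ξ_k) = ord ρ`», multiplicative convention); and the FORMAL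
  CHAIN (2)/(3)/(4) with `ℓ = ev F`, `x = ev X`, `𝓛(𝟙) = ev (C (F 0))` for any evaluation
  `ev : R⟦X⟧ →+* S` on a `v`-integral ring: `map_constantCoeff_mul_eq_of_interpolation_of_lt` ((2):
  `v x · v A₀ < v A ⇒ v (ev (C (F 0))) · v A₀ = v A`), `…_of_lt'` ((3)), `map_le_max_mul_of_interpolation`
  ((4)). Inputs (iii)(iv)(v) are HYPOTHESES (equalities / valuation identities between ring elements);
  nothing is constructed and no [BKNO] statement is used.
* §B EVALUATION AT THE POINTS OF `pℤ_p` (making the `ev`-quantified §3 of the companion concrete),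
  over the tree's `padicInt_hasEval` / `padicInt_isLinearTopology` / `evalHom t ht : Λ →+* ℤ_[p]`
  (`Literature/NumberTheory/EllipticCurves/PadicSeriesEvaluation.lean`): `aeval_X_eq` (`T ↦ t`),
  `aeval_eq_evalHom`, `hasSum_aeval` (`F(t) = ∑ F_d t^d`), and the transfers at `t`:
  `norm_constantCoeff_eq_of_lt_evalHom` ((a) `‖t‖ < ‖F(t)‖ ⇒ ‖F 0‖ = ‖F(t)‖`),
  `norm_evalHom_eq_of_lt` ((b)), `norm_evalHom_le_max` ((c)), the `PadicInt.valuation` forms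
  `constantCoeff_valuation_eq_of_lt_evalHom` / `evalHom_valuation_eq_of_lt` (currency of
  `Castella2018.AcSelmer.XAc.HasCharValuationAt`), and `norm_constantCoeff_eq_of_hasSum_of_lt`
  ((a) for the convergent sum itself, no homomorphism in the statement).
* §C (appended) the UNIT-MEMBER input (v), formal part: `map_eval_eq_one_of_constantCoeff`
  (`v (ev (C (F 0))) = 1 ⇒ v (ev F) = 1` at `v (ev X) < 1`), `isUnit_iff_isUnit_constantCoeff` /
  `isUnit_eval_of_isUnit_constantCoeff` (`𝓛 ∈ Λ^× ⟺ 𝓛(0) ∈ R^×` ⇒ unit values), and on `ℤ_[p]⟦T⟧`: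
  `isUnit_iff_norm_constantCoeff_eq_one`, `norm_evalHom_eq_one_of_norm_constantCoeff_eq_one`,
  `norm_evalHom_lt_one_of_norm_constantCoeff_lt_one`.
NOT here: `𝒪_𝔭⟦X⟧`-valued objects of [BKNO], de Rham characters, the archimedean identity S_arch
(planner g21 pen (4)); no statement item is filed.
References: [BKNO] arXiv:2608.06879 Def. 4.7, Thm 4.12 (shape of (iii) only) [BurungaleKobayashiNakamuraOta2026];
J.-P. Serre, *Local Fields* (1979) Ch. II §1 [Serre1979]; L. Washington, *Introduction to Cyclotomic
Fields* (1997) §7.2 [Washington1997]; memo RELATIVE-RUBIN-ram-g9.md §1, §5, §6.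
-/

namespace Summit.BirchSwinnertonDyer.BirchSwinnertonDyer.Theorems.RamifiedSevenEllipticUnits.Ultrametric

open PowerSeries Filter Topology Literature.NumberTheory.EllipticCurves

/-! ## §A The RELATIVE VALUATION bookkeeping (memo RELATIVE-RUBIN §1 (RR) and THEOREM (1)–(4)) -/

section Relative

variable {S : Type*} [CommRing S] {Γ₀ : Type*} [LinearOrderedCommGroupWithZero Γ₀]
  (v : Valuation S Γ₀)

/-- **(RR) — the RELATIVE VALUATION IDENTITY, formal part.** Two «interpolation identities»
`ℓ · per = A` (member `D`: `ℓ = 𝓛_D(ξ)`, `per` its `p`-adic period, `A` the algebraic `L`-value) and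
`ℓ₀ · per₀ = A₀` (member `D₀`), periods of the same valuation (`v per = v per₀`, the D-independence input
(iv)) and a UNIT member (`v ℓ₀ = 1`, input (v)) give `v ℓ · v A₀ = v A` — «`ord_π 𝓛_D(ξ_k) =
ord_π ρ_k(D; D₀)`». Inputs (iii) [BKNO Thm 4.12], (iv), (v) are HYPOTHESES here; nothing is
constructed. [cite: BurungaleKobayashiNakamuraOta2026, Thm. 4.12 and Def. 4.7 (arXiv:2608.06879 pp. 27, 32) (claim; preprint; shape only)] -/
theorem map_mul_eq_of_interpolation {ℓ ℓ₀ per per₀ A A₀ : S} (hD : ℓ * per = A) (hD₀ : ℓ₀ * per₀ = A₀)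
    (hper : v per = v per₀) (hunit : v ℓ₀ = 1) : v ℓ * v A₀ = v A := by
  rw [← hD, ← hD₀, map_mul, map_mul, hunit, one_mul, hper]

/-- From (RR): the strict comparison `v x · v A₀ < v A` («`v < ord_π x`», additively
`ord A − ord A₀ < ord x`) forces `v A₀ ≠ 0` and `v x < v ℓ` («`ord ℓ < ord x`»).
[cite: BurungaleKobayashiNakamuraOta2026, Thm. 4.12 (arXiv:2608.06879 p. 32) (claim; preprint; shape only)] -/
theorem map_lt_of_interpolation {ℓ ℓ₀ per per₀ A A₀ x : S} (hD : ℓ * per = A)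
    (hD₀ : ℓ₀ * per₀ = A₀) (hper : v per = v per₀) (hunit : v ℓ₀ = 1)
    (hlt : v x * v A₀ < v A) : v x < v ℓ := by
  have hRR := map_mul_eq_of_interpolation v hD hD₀ hper hunit
  rw [← hRR] at hlt
  have hA₀ : v A₀ ≠ 0 := by
    rintro h0
    rw [h0, mul_zero, mul_zero] at hlt
    exact lt_irrefl _ hlt
  rw [mul_comm (v x), mul_comm (v ℓ)] at hlt
  exact lt_of_mul_lt_mul_of_le₀ hlt (zero_lt_iff.2 hA₀) le_rfl

variable {R : Type*} [CommRing R]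

/-- **THE RELATIVE RUBIN VALUATION THEOREM, formal chain — part (2)** (memo §1 THEOREM (2)): on a
`v`-integral `S`, for `F ∈ R⟦X⟧` and an evaluation `ev` (`ℓ := ev F` = «`𝓛_D(ξ_k)`», `x := ev X` =
«`u^k − 1`», `ev (C (F 0))` = «`𝓛_D(𝟙)`»), GIVEN the interpolation identities with periods of equal
valuation and a unit member: if `v x · v A₀ < v A` («`v < 1 + 2m`», additively) then
`v (ev (C (F 0))) · v A₀ = v A` («`λ₀(D) = v`», and `𝓛_D(𝟙) ≠ 0` valuatively). The ultrametric step is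
`…Ultrametric.map_const_eq_of_lt`. [cite: BurungaleKobayashiNakamuraOta2026, Thm. 4.12 and Def. 4.7 (arXiv:2608.06879 pp. 27, 32) (claim; preprint; shape only)] -/
theorem map_constantCoeff_mul_eq_of_interpolation_of_lt (hint : ∀ s : S, v s ≤ 1)
    (ev : R⟦X⟧ →+* S) (F : R⟦X⟧) {ℓ₀ per per₀ A A₀ : S} (hD : ev F * per = A) (hD₀ : ℓ₀ * per₀ = A₀)
    (hper : v per = v per₀) (hunit : v ℓ₀ = 1) (hlt : v (ev X) * v A₀ < v A) :
    v (ev (C (constantCoeff F))) * v A₀ = v A := by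
  rw [map_eval_C_constantCoeff_eq_of_lt v hint ev F (map_lt_of_interpolation v hD hD₀ hper hunit hlt)]
  exact map_mul_eq_of_interpolation v hD hD₀ hper hunit

/-- **Formal chain — part (3)** (memo §1 THEOREM (3)): if instead `v (ev X) < v (ev (C (F 0)))`
(«`λ₀(D) < 1 + 2m`») then again `v (ev (C (F 0))) · v A₀ = v A` («`v = λ₀(D)`»), by
`…Ultrametric.map_eval_eq_of_lt`. [cite: BurungaleKobayashiNakamuraOta2026, Thm. 4.12 and Def. 4.7 (arXiv:2608.06879 pp. 27, 32) (claim; preprint; shape only)] -/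
theorem map_constantCoeff_mul_eq_of_interpolation_of_lt' (hint : ∀ s : S, v s ≤ 1)
    (ev : R⟦X⟧ →+* S) (F : R⟦X⟧) {ℓ₀ per per₀ A A₀ : S} (hD : ev F * per = A) (hD₀ : ℓ₀ * per₀ = A₀)
    (hper : v per = v per₀) (hunit : v ℓ₀ = 1) (hlt : v (ev X) < v (ev (C (constantCoeff F)))) :
    v (ev (C (constantCoeff F))) * v A₀ = v A := by
  rw [← map_eval_eq_of_lt v hint ev F hlt]
  exact map_mul_eq_of_interpolation v hD hD₀ hper hunit

/-- **Formal chain — part (4)** (memo §1 THEOREM (4)): unconditionally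
`v A ≤ max (v (ev (C (F 0)))) (v (ev X)) · v A₀` («`v ≥ min(λ₀(D), 1 + 2m)`»).
[cite: BurungaleKobayashiNakamuraOta2026, Thm. 4.12 and Def. 4.7 (arXiv:2608.06879 pp. 27, 32) (claim; preprint; shape only)] -/
theorem map_le_max_mul_of_interpolation (hint : ∀ s : S, v s ≤ 1) (ev : R⟦X⟧ →+* S) (F : R⟦X⟧)
    {ℓ₀ per per₀ A A₀ : S} (hD : ev F * per = A) (hD₀ : ℓ₀ * per₀ = A₀) (hper : v per = v per₀)
    (hunit : v ℓ₀ = 1) : v A ≤ max (v (ev (C (constantCoeff F)))) (v (ev X)) * v A₀ := by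
  rw [← map_mul_eq_of_interpolation v hD hD₀ hper hunit]
  exact mul_le_mul_left ((map_eval_le_max v hint ev F).1) _

end Relative

/-! ## §B Evaluation homomorphisms of `Λ = ℤ_[p]⟦T⟧` at the points of `pℤ_p` (the tree's
`padicInt_hasEval` / `evalHom`, `Literature/NumberTheory/EllipticCurves/PadicSeriesEvaluation.lean`) -/

section PadicEval
variable {p : ℕ} [Fact p.Prime]

/-- **The evaluation `Λ → ℤ_[p]` at a point `t` of `pℤ_p` as a `ℤ_[p]`-ALGEBRA homomorphism**
(Mathlib's `PowerSeries.aeval` over the tree's `padicInt_hasEval` / `padicInt_isLinearTopology`):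
it sends `T ↦ t`. [cite: Washington1997, §7.2] -/
theorem aeval_X_eq {t : ℤ_[p]} (ht : ‖t‖ < 1) :
    PowerSeries.aeval (padicInt_hasEval ht) (X : IwasawaAlgebra p) = t := by
  rw [← Polynomial.coe_X, PowerSeries.aeval_coe, Polynomial.aeval_X]

/-- Its values agree with the tree's ring homomorphism `evalHom t ht`. [cite: Washington1997, §7.2] -/
theorem aeval_eq_evalHom {t : ℤ_[p]} (ht : ‖t‖ < 1) (F : IwasawaAlgebra p) :
    PowerSeries.aeval (padicInt_hasEval ht) F = evalHom t ht F := by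
  rw [evalHom_apply, ← Algebra.algebraMap_self, ← PowerSeries.coe_aeval (padicInt_hasEval ht)]

/-- Its value at `F` is the convergent sum `∑ F_d t^d`. [cite: Washington1997, §7.2] -/
theorem hasSum_aeval {t : ℤ_[p]} (ht : ‖t‖ < 1) (F : IwasawaAlgebra p) :
    HasSum (fun d ↦ coeff d F * t ^ d) (PowerSeries.aeval (padicInt_hasEval ht) F) := by
  simpa only [smul_eq_mul] using PowerSeries.hasSum_aeval (padicInt_hasEval ht) F

/-- **Transfer (a) at a point of `pℤ_p`**: `‖t‖ < ‖F(t)‖ ⇒ ‖F 0‖ = ‖F(t)‖` for the tree's evaluation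
(`F(t) = evalHom t ht F`) — «`ord_p F(t) < ord_p t ⇒ ord_p F(0) = ord_p F(t)`».
[cite: Washington1997, §7.2] -/
theorem norm_constantCoeff_eq_of_lt_evalHom {t : ℤ_[p]} (ht : ‖t‖ < 1) (F : IwasawaAlgebra p)
    (hlt : ‖t‖ < ‖evalHom t ht F‖) : ‖constantCoeff F‖ = ‖evalHom t ht F‖ := by
  rw [← aeval_eq_evalHom ht] at hlt ⊢
  exact norm_constantCoeff_eq_of_lt _ F (by rwa [aeval_X_eq ht])

/-- **Transfer (b) at a point of `pℤ_p`**: `‖t‖ < ‖F 0‖ ⇒ ‖F(t)‖ = ‖F 0‖`. [cite: Washington1997, §7.2] -/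
theorem norm_evalHom_eq_of_lt {t : ℤ_[p]} (ht : ‖t‖ < 1) (F : IwasawaAlgebra p)
    (hlt : ‖t‖ < ‖constantCoeff F‖) : ‖evalHom t ht F‖ = ‖constantCoeff F‖ := by
  rw [← aeval_eq_evalHom ht]
  exact norm_eval_eq_of_lt _ F (by rwa [aeval_X_eq ht])

/-- **Transfer (c) at a point of `pℤ_p`**: `‖F(t)‖ ≤ max ‖F 0‖ ‖t‖` and `‖F 0‖ ≤ max ‖F(t)‖ ‖t‖`.
[cite: Washington1997, §7.2] -/
theorem norm_evalHom_le_max {t : ℤ_[p]} (ht : ‖t‖ < 1) (F : IwasawaAlgebra p) :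
    ‖evalHom t ht F‖ ≤ max ‖constantCoeff F‖ ‖t‖ ∧ ‖constantCoeff F‖ ≤ max ‖evalHom t ht F‖ ‖t‖ := by
  have h := norm_eval_le_max (PowerSeries.aeval (padicInt_hasEval ht)) F
  rwa [aeval_X_eq ht, aeval_eq_evalHom ht] at h

/-- **Transfer (a), `PadicInt.valuation` currency** (the «`ord_p f(0)`» of
`Castella2018.AcSelmer.XAc.HasCharValuationAt`): for `t ≠ 0` in `pℤ_p` and `F(t) ≠ 0` with
`F(t).valuation < t.valuation`: `F 0 ≠ 0 ∧ (F 0).valuation = F(t).valuation`. [cite: Washington1997, §7.2] -/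
theorem constantCoeff_valuation_eq_of_lt_evalHom {t : ℤ_[p]} (ht : ‖t‖ < 1) (ht0 : t ≠ 0)
    (F : IwasawaAlgebra p) (hF : evalHom t ht F ≠ 0)
    (hlt : (evalHom t ht F).valuation < t.valuation) :
    constantCoeff F ≠ 0 ∧ (constantCoeff F).valuation = (evalHom t ht F).valuation := by
  rw [← aeval_eq_evalHom ht] at hF hlt ⊢
  have hX : PowerSeries.aeval (padicInt_hasEval ht) (X : IwasawaAlgebra p) ≠ 0 := by
    rwa [aeval_X_eq ht]
  exact constantCoeff_valuation_eq_of_lt _ F hF hX (by rwa [aeval_X_eq ht])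

/-- **Transfer (b), `PadicInt.valuation` currency**: for `t ≠ 0` in `pℤ_p` and `F 0 ≠ 0` with
`(F 0).valuation < t.valuation`: `F(t) ≠ 0 ∧ F(t).valuation = (F 0).valuation`. [cite: Washington1997, §7.2] -/
theorem evalHom_valuation_eq_of_lt {t : ℤ_[p]} (ht : ‖t‖ < 1) (ht0 : t ≠ 0) (F : IwasawaAlgebra p)
    (h0 : constantCoeff F ≠ 0) (hlt : (constantCoeff F).valuation < t.valuation) :
    evalHom t ht F ≠ 0 ∧ (evalHom t ht F).valuation = (constantCoeff F).valuation := by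
  rw [← aeval_eq_evalHom ht]
  have hX : PowerSeries.aeval (padicInt_hasEval ht) (X : IwasawaAlgebra p) ≠ 0 := by
    rwa [aeval_X_eq ht]
  exact eval_valuation_eq_of_lt _ F h0 hX (by rwa [aeval_X_eq ht])

/-- **Transfer (a) for the convergent sum itself**: if `s = ∑ F_d t^d` (`HasSum`) and `‖t‖ < ‖s‖`
then `‖F 0‖ = ‖s‖` — the VALUE named by its series, no homomorphism in the statement.
[cite: Washington1997, §7.2] -/
theorem norm_constantCoeff_eq_of_hasSum_of_lt {t s : ℤ_[p]} (ht : ‖t‖ < 1) (F : IwasawaAlgebra p)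
    (hs : HasSum (fun d ↦ coeff d F * t ^ d) s) (hlt : ‖t‖ < ‖s‖) : ‖constantCoeff F‖ = ‖s‖ := by
  have hFs : evalHom t ht F = s := by rw [← aeval_eq_evalHom ht]; exact (hasSum_aeval ht F).unique hs
  rw [← hFs] at hlt ⊢
  exact norm_constantCoeff_eq_of_lt_evalHom ht F hlt

end PadicEval

/-! ## §C The UNIT-MEMBER input (memo RELATIVE-RUBIN §1 (v)), formal part: «`λ₀(D₀) = 0 ⟺
`𝓛_{D₀} ∈ Λ^×` ⟺ every value `ξ(𝓛_{D₀})` is a unit» — a power series is a unit iff its constant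
term is, and then all its values at points of the maximal ideal are units (appended, seat
`bsd-cm-k7r-c3` g8) -/

section UnitMember

variable {S : Type*} [CommRing S] {Γ₀ : Type*} [LinearOrderedCommGroupWithZero Γ₀]
  (v : Valuation S Γ₀) {R : Type*} [CommRing R]

/-- **Unit constant term ⇒ unit values (valuation currency).** On a `v`-integral `S`, for any
evaluation `ev : R⟦X⟧ →+* S` at a point of the «maximal ideal» (`v (ev X) < 1`): if
`v (ev (C (F 0))) = 1` («`ord 𝓛(𝟙) = λ₀ = 0`») then `v (ev F) = 1` («every value `𝓛(ξ)` is a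
unit»). This is transfer (b) at `v c = 1`; it is how the unit member `D₀` feeds (RR)
(`map_mul_eq_of_interpolation`'s hypothesis `v ℓ₀ = 1`). [cite: Washington1997, §7.2] -/
theorem map_eval_eq_one_of_constantCoeff (hint : ∀ s : S, v s ≤ 1) (ev : R⟦X⟧ →+* S) (F : R⟦X⟧)
    (hX : v (ev X) < 1) (h1 : v (ev (C (constantCoeff F))) = 1) : v (ev F) = 1 := by
  rw [← h1] at hX ⊢
  exact map_eval_eq_of_lt v hint ev F hX

/-- **`𝓛 ∈ Λ^× ⟺ 𝓛(𝟙) ∈ R^×`**: a power series is a unit iff its constant term is (Mathlib's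
`PowerSeries.isUnit_iff_constantCoeff`, recorded in the cell's reading «`λ₀(D₀) = 0 ⟺
𝓛_{D₀} ∈ Λ^×`»). [cite: Washington1997, §7.1 (units of `Λ`)] -/
theorem isUnit_iff_isUnit_constantCoeff (F : R⟦X⟧) : IsUnit F ↔ IsUnit (constantCoeff F) :=
  PowerSeries.isUnit_iff_constantCoeff

/-- … and a unit of `R⟦X⟧` has unit values under EVERY ring homomorphism (no valuation needed).
[cite: Washington1997, §7.1] -/
theorem isUnit_eval_of_isUnit_constantCoeff (ev : R⟦X⟧ →+* S) (F : R⟦X⟧)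
    (h : IsUnit (constantCoeff F)) : IsUnit (ev F) :=
  (PowerSeries.isUnit_iff_constantCoeff.2 h).map ev

variable {p : ℕ} [Fact p.Prime]

/-- **The `Λ = ℤ_[p]⟦T⟧` instance**: `‖F 0‖ = 1` (`⟺ F 0 ∈ ℤ_p^×`, `PadicInt.isUnit_iff`; «`ord_p
F(0) = 0`») ⟺ `F ∈ Λ^×`. [cite: Washington1997, §7.1] -/
theorem isUnit_iff_norm_constantCoeff_eq_one (F : IwasawaAlgebra p) :
    IsUnit F ↔ ‖constantCoeff F‖ = 1 := by
  rw [PowerSeries.isUnit_iff_constantCoeff, PadicInt.isUnit_iff]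

/-- … and then every value at a point of `pℤ_p` is a `p`-adic unit: `‖F(t)‖ = 1` for the tree's
`evalHom t ht` («every `ξ(𝓛_{D₀})` is a unit»). [cite: Washington1997, §7.1] -/
theorem norm_evalHom_eq_one_of_norm_constantCoeff_eq_one {t : ℤ_[p]} (ht : ‖t‖ < 1)
    (F : IwasawaAlgebra p) (h1 : ‖constantCoeff F‖ = 1) : ‖evalHom t ht F‖ = 1 :=
  PadicInt.isUnit_iff.1
    (isUnit_eval_of_isUnit_constantCoeff (evalHom t ht) F (PadicInt.isUnit_iff.2 h1))

/-- Conversely a NON-unit constant term is seen at every small point: if `‖F 0‖ < 1` then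
`‖F(t)‖ ≤ max ‖F 0‖ ‖t‖ < 1` for `‖t‖ < 1` — no value at a point of `pℤ_p` is a unit («`λ₀(D) > 0 ⇒`
no `ξ(𝓛_D)` with `ξ(γ) ∈ 1 + pℤ_p` is a unit»). [cite: Washington1997, §7.2] -/
theorem norm_evalHom_lt_one_of_norm_constantCoeff_lt_one {t : ℤ_[p]} (ht : ‖t‖ < 1)
    (F : IwasawaAlgebra p) (h1 : ‖constantCoeff F‖ < 1) : ‖evalHom t ht F‖ < 1 :=
  lt_of_le_of_lt (norm_evalHom_le_max ht F).1 (max_lt h1 ht)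

end UnitMember

end Summit.BirchSwinnertonDyer.BirchSwinnertonDyer.Theorems.RamifiedSevenEllipticUnits.Ultrametric
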